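import Summits.Ventures.YMGap.RobustBall.RobustStarDoor
import Summits.Ventures.YMGap.RobustBall.RobustStarReceivedSumW
import Summits.Ventures.YMGap.RobustBall.RobustStarCertificateW
import HarnessLib

/-!
# Venture YMGap, track ROBUST-BALL (Y2) — crux Y2-X2-W, step W5: THE ROBUST VERTEX-STAR DOOR ON THE TIER-2
# (WEIGHTED, INFINITE-RANGE) BALL `ClusterDomain κ ε₀ ε₁` ⇒ torus clustering, uniformly in `L`

HONEST FRAMING. WHAT THIS IS: a venture file (cell `pub-ymgap`, track Y2 ROBUST-BALL, seat ds-2): the assembly of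
W1–W4 — the tier-2 twin of `RobustStarDoor.lean`. For `SU(N)` (`N ≥ 1`) on `(ℤ/L)^d` (`d ≥ 2`, every `L ≥ 3`), a
one-link Kantorovich–Rubinstein modulus `OneLinkKRModulus N R K` on `R ≥ 2(d−1)|β|/N`, a weight `κ ≥ t ≥ 0` and a
member `W` of the TIER-2 ball `ClusterDomain κ ε₀ ε₁` (NO range cut-off: `e^{κ·diam}`-weighted oscillation load
`≤ ε₀` and Lipschitz load `≤ ε₁` — the directive's weighted non-local Banach ball): with
`c ≥ K e^{ε₀}(1 + 2√N ε₁)|β|/N`, `λ ≥ √N ε₁`, `θ = (2d−2)c + λ < 1`, `doorPoly d c < 1` and the WEIGHTED ROBUST STAR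
DOOR `ρ = e^{t}·(R_G^{(d)}(c) + (e^{2t}λ + θ^K·4d·e^{2t}λ)/(1 − θ)) < 1`, the member's torus measure CLUSTERS at RATE
`t` per lattice unit: `ClustersWith W β (2(2√N)² e^{2t}) t` — constants depending on `(N, d, c, λ, θ, K, t)` only,
i.e. UNIFORMLY in `L` and in the member: `TorusClusteringOnBallW`, its up-to-`β⋆` form, and (for `d = 3`) Y4's
`ClusterDomainClustering` on the weighted ball. MECHANISM: g7's robust star array `Krob` (range-free) + its
`e^{t·reach}`-weighted received sum (`sum_Krob_mul_le'`, W4) + the WEIGHTED Dobrushin–Shlosman window iteration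
(`spec_star_abs_covariance_le_weighted`, W3, on lit's `DobrushinShlosmanWeightedStates`) — the finite influence
radius the `ℕ`-profile needed (HANDOFF-ds2 g7/g8: "tier-2 star door not possible") is no longer used. Today's
tier-2 torus rows come from the single-link door `su2_torusClusteringOnBallW_quarter` (Wilson threshold
`2e^{−κ}/9 < 2/9` for `SU(2)`, `d = 4`); the star door's Wilson threshold at `t → 0` is `9/25`.
WHAT THIS IS NOT: no number (rows are `TorusRowsSU2StarW`); torus currency only (the `ℤ^d` DLR-uniqueness half of a
tier-2 star row needs the infinite-range window analogue of `DobrushinMetricInfiniteRange` and is NOT claimed);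
radii/rates are door artefacts; strong-coupling lattice statements — nothing about the continuum or the Millennium
problem.

## References
* H.-O. Georgii (2011) Remark 8.26; H. Künsch, CMP 84 (1982); H. Föllmer, LNM 1362 (1988) Ch. I;
  R. L. Dobrushin, S. B. Shlosman (1985).
* The tree: `RobustStarDoor` (g7, followed line by line), `RobustStarReceivedSumW`, `RobustStarCertificateW`,
  `TorusDoor` (the tier-2 single-link matrix), `TorusClusteringYM3` (Y4 bridge).
-/

noncomputable section

open MeasureTheory ProbabilityTheory Function Finset
open Literature.Probability.LatticeModels
open Literature.Probability.LatticeModels.DobrushinMetric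
open Literature.MathematicalPhysics.QuantumLattice (fundamentalRep)
open Literature.MathematicalPhysics.QuantumFieldTheory hiding ZdEdge
open Literature.MathematicalPhysics.QuantumFieldTheory.Balaban1983to89.StrongCouplingTorusWindow
open Literature.MathematicalPhysics.QuantumFieldTheory.Balaban1983to89.StrongCouplingDobrushinWindow
  (OneLinkKRModulus)
open Summit.Ventures.YMGap.DSWindow
open Summit.Ventures.YMGap.StarKernel
open Summit.Ventures.YMGap.StarResolventDim (Delta gaugeR doorPoly Delta_pos_of_door gaugeR_lt_one_of_door)
open Summit.Ventures.YMGap.StarLemmaGDim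
open Summit.Ventures.YMGap.RobustStar

namespace Summit.Ventures.YMGap.RobustBall

variable {d L N : ℕ} [NeZero L]

/-! ### Geometry of the reach weight and the weighted cross row -/

/-- **Reach of a polymer partner from a star vertex**: if `x` is a star link of `s` and the links `x, y` both belong
to the polymer `X` (base points in `X`), then every endpoint of `y` is within sup-distance `diam X + 2` of `s`. [folklore] -/
theorem sup_torusNorm_sub_linkEnds_le {s : Site d L} {x y : Edge d L} (hx : x ∈ vertexStar s) {X : Finset (Site d L)}
    (hxX : x.1 ∈ X) (hyX : y.1 ∈ X) :
    ((linkEnds y).sup fun w => torusNorm (s - w)) ≤ polymerDiam X + 2 := by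
  refine Finset.sup_le fun w hw => ?_
  have h1 : torusNorm (s - x.1) ≤ 1 := torusNorm_sub_fst_le_one_of_mem_vertexStar hx
  have h2 : torusNorm (x.1 - y.1) ≤ polymerDiam X := torusNorm_sub_le_polymerDiam hxX hyX
  have h3 : torusNorm (y.1 - w) ≤ 1 := torusNorm_fst_sub_linkEnds_le_one hw
  have t1 := torusNorm_sub_le s x.1 y.1
  have t2 := torusNorm_sub_le s y.1 w
  omega

variable {W : Perturbation d L N}

/-- The cross-Lipschitz load is monotone in the weight. [folklore] -/
theorem crossLipLoad_mono (w : LoadWitness W) {t κ : ℝ} (ht : t ≤ κ) (e : Edge d L) :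
    w.crossLipLoad t e ≤ w.crossLipLoad κ e := by
  refine Finset.sum_le_sum fun y _ => Finset.sum_le_sum fun X _ =>
    mul_le_mul_of_nonneg_right (Real.exp_le_exp.2 ?_) ((w.lip_spec X).nonneg y)
  exact mul_le_mul_of_nonneg_right ht (Nat.cast_nonneg _)

/-- **Weighted cross row with the reach weight**: for a star link `x` of `s` and `t ≥ 0`,
`∑_{y ≠ x} ℓ_0(x,y) e^{t·reach(s,y)} ≤ e^{2t} Λ_t(x)` (`reach(s,y) = max_{w ∈ ends y} ‖s − w‖_∞ ≤ diam X + 2`). [folklore] -/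
theorem sum_erase_crossLip_mul_exp_reach_le (w : LoadWitness W) {t : ℝ} (ht : 0 ≤ t) {s : Site d L} {x : Edge d L}
    (hx : x ∈ vertexStar s) :
    ∑ y ∈ univ.erase x, w.crossLip 0 x y *
        Real.exp (t * (((linkEnds y).sup fun w => torusNorm (s - w) : ℕ) : ℝ)) ≤
      Real.exp (2 * t) * w.crossLipLoad t x := by
  unfold LoadWitness.crossLipLoad
  rw [Finset.mul_sum]
  refine Finset.sum_le_sum fun y _ => ?_
  unfold LoadWitness.crossLip
  rw [Finset.sum_mul, Finset.mul_sum]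
  refine Finset.sum_le_sum fun X hX => ?_
  obtain ⟨hXe, hXy⟩ := Finset.mem_filter.1 hX
  have heX : x.1 ∈ X := (mem_polymersThroughEdge.1 hXe).2
  have hyX : y.1 ∈ X := mem_polymerEdges_one.1 hXy
  have hreach := sup_torusNorm_sub_linkEnds_le hx heX hyX
  have hlip0 : 0 ≤ w.lip X y := (w.lip_spec X).nonneg y
  rw [zero_mul, Real.exp_zero, one_mul]
  calc w.lip X y * Real.exp (t * (((linkEnds y).sup fun w => torusNorm (s - w) : ℕ) : ℝ))
      ≤ w.lip X y * Real.exp (t * ((polymerDiam X : ℝ) + 2)) := by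
        refine mul_le_mul_of_nonneg_left (Real.exp_le_exp.2 (mul_le_mul_of_nonneg_left ?_ ht)) hlip0
        exact_mod_cast hreach
    _ = Real.exp (2 * t) * (Real.exp (t * polymerDiam X) * w.lip X y) := by
        rw [show t * ((polymerDiam X : ℝ) + 2) = 2 * t + t * polymerDiam X by ring, Real.exp_add]; ring

/-! ### One member: the weighted robust star door ⇒ `ClustersWith` at rate `t` -/

/-- **THE ROBUST STAR DOOR FOR ONE TIER-2 MEMBER ⇒ `ClustersWith` AT RATE `t`.** See the module docstring for the
constants; `c` is any upper bound of the robust per-incidence coefficient and `0 ≤ t ≤ κ`. [folklore] -/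
theorem clustersWith_of_robustStarW (hd : 2 ≤ d) (hN : 1 ≤ N) (hL : 3 ≤ L) {β κ ε₀ ε₁ R K c lam θ ρ t : ℝ} {Kn : ℕ}
    (hK : 0 ≤ K) (hR : |β| / N * (2 * ((d : ℝ) - 1)) ≤ R) (hmod : OneLinkKRModulus N R K) (hε₁ : 0 ≤ ε₁)
    (ht : 0 ≤ t) (htκ : t ≤ κ)
    (hc : K * Real.exp ε₀ * (1 + 2 * Real.sqrt N * ε₁) * (|β| / N) ≤ c) (hlam : Real.sqrt N * ε₁ ≤ lam)
    (hθ : θ = (2 * (d : ℝ) - 2) * c + lam) (hθ1 : θ < 1) (hcd : doorPoly d c < 1)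
    (hρ : ρ = Real.exp t * (gaugeR d c +
      (Real.exp (2 * t) * lam + θ ^ Kn * (4 * d * (Real.exp (2 * t) * lam))) / (1 - θ))) (hρ1 : ρ < 1)
    {W : Perturbation d L N} (hW : W ∈ ClusterDomain κ ε₀ ε₁) :
    ClustersWith W β (2 * (2 * Real.sqrt N) ^ 2 * Real.exp (2 * t)) t := by
  classical
  obtain ⟨w, hwa, hwℓ⟩ := exists_witness_of_mem_clusterDomain hW
  have hκ : 0 ≤ κ := ht.trans htκ
  have hL1 : 1 < L := by omega
  have hd1 : 1 ≤ d := by omega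
  have hc0 : 0 ≤ c := le_trans (by positivity) hc
  have hlam0 : 0 ≤ lam := le_trans (by positivity) hlam
  have hΔ : 0 < Delta d c := Delta_pos_of_door hd hc0 hcd
  have hgR : 0 ≤ gaugeR d c ∧ gaugeR d c < 1 := gaugeR_lt_one_of_door hd hc0 hcd
  have hd2 : (2 : ℝ) ≤ d := by exact_mod_cast hd
  have hθ0 : 0 ≤ θ := by rw [hθ]; nlinarith
  have h1θ : 0 < 1 - θ := by linarith
  have het : 1 ≤ Real.exp t := Real.one_le_exp ht
  have hρ0 : 0 ≤ ρ := by
    rw [hρ]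
    refine mul_nonneg (Real.exp_pos _).le (add_nonneg hgR.1 (div_nonneg (add_nonneg (by positivity) ?_) h1θ.le))
    have : 0 ≤ θ ^ Kn := pow_nonneg hθ0 Kn
    positivity
  -- the robust single-link matrix with the (range-free) off-column array `E`
  set E : Edge d L → Edge d L → ℝ := fun x z => Real.sqrt N * w.crossLip 0 x z with hEdef
  have hE0 : ∀ x z, 0 ≤ E x z := fun x z => mul_nonneg (Real.sqrt_nonneg _) (crossLip_nonneg w 0 x z)
  have hKR := isKRContraction_perturbedTorusSpec hd1 hN hL1 hK hR hmod w (β := β)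
  have hcoef : ∀ x : Edge d L,
      K * Real.exp (w.oscLoad 0 x) * (1 + 2 * Real.sqrt N * w.selfLipLoad 0 x) * (|β| / N) ≤ c := by
    intro x
    refine le_trans ?_ hc
    have h1 : Real.exp (w.oscLoad 0 x) ≤ Real.exp ε₀ :=
      Real.exp_le_exp.2 ((oscLoad_zero_le w hκ x).trans (hwa x))
    have h2 : w.selfLipLoad 0 x ≤ ε₁ := by
      linarith [selfLipLoad_zero_le w hκ x, hwℓ x, crossLipLoad_nonneg w κ x]
    have h3 : 0 ≤ w.selfLipLoad 0 x := selfLipLoad_nonneg w 0 x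
    gcongr
  have hKR' : IsKRContraction (perturbedTorusSpec W β) suFrobDist (fun e => univ.erase e) (Cst c E) := by
    refine isKRContraction_univ_of_le hKR (fun a b => suFrobDist_nonneg a b) (Cst_nonneg hc0 hE0) fun x y _ => ?_
    have ht' : (0 : ℝ) ≤ tInfluence x y := Nat.cast_nonneg _
    simp only [Cst, hEdef]
    nlinarith [mul_nonneg (sub_nonneg.2 (hcoef x)) ht']
  have hlamrow : ∀ x, ∑ z ∈ univ.erase x, E x z ≤ lam := by
    intro x
    calc ∑ z ∈ univ.erase x, E x z = Real.sqrt N * w.crossLipLoad 0 x := by rw [hEdef, ← mul_sum]; rfl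
      _ ≤ Real.sqrt N * ε₁ := by
          refine mul_le_mul_of_nonneg_left ?_ (Real.sqrt_nonneg _)
          linarith [crossLipLoad_mono w hκ x, hwℓ x, selfLipLoad_nonneg w κ x]
      _ ≤ lam := hlam
  have hrow : ∀ (s : Site d L), ∀ x ∈ vertexStar s, ∑ z ∈ (vertexStar s).erase x, Cst c E x z ≤ θ := by
    intro s x hx; rw [hθ]; exact sum_star_erase_Cst_le hL hc0 hE0 hlamrow hx
  -- (H1) and the WEIGHTED (H2) with the reach weight `e^{t·reach(s,y)}`
  have hcontract := robust_star_window (W := W) (β := β) hd hL hc0 hΔ hE0 hθ0 hθ1 hrow hKR' Kn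
  have hsumw : ∀ (s : Site d L) (x : Edge d L), x ∈ vertexStar s →
      ∑ y, Krob c E θ Kn s y x * Real.exp (t * (((linkEnds y).sup fun w => torusNorm (s - w) : ℕ) : ℝ)) ≤ ρ := by
    intro s x hx
    have hφ1 : ∀ y : Edge d L, 1 ≤ Real.exp (t * (((linkEnds y).sup fun w => torusNorm (s - w) : ℕ) : ℝ)) :=
      fun y => Real.one_le_exp (mul_nonneg ht (Nat.cast_nonneg _))
    have hΦb : ∀ y ∈ starBoundary s,
        Real.exp (t * (((linkEnds y).sup fun w => torusNorm (s - w) : ℕ) : ℝ)) ≤ Real.exp t := by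
      intro y hy
      refine Real.exp_le_exp.2 ?_
      have h1 : ((linkEnds y).sup fun w => torusNorm (s - w)) ≤ 1 :=
        Finset.sup_le fun w hw => torusNorm_le_one_of_mem_starBoundary hy hw
      have h1' : (((linkEnds y).sup fun w => torusNorm (s - w) : ℕ) : ℝ) ≤ 1 := by exact_mod_cast h1
      nlinarith
    have hlamφ : ∀ x ∈ vertexStar s, ∑ z ∈ univ.erase x,
        E x z * Real.exp (t * (((linkEnds z).sup fun w => torusNorm (s - w) : ℕ) : ℝ)) ≤ Real.exp (2 * t) * lam := by
      intro x hx
      have h1 := sum_erase_crossLip_mul_exp_reach_le w ht hx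
      calc ∑ z ∈ univ.erase x, E x z * Real.exp (t * (((linkEnds z).sup fun w => torusNorm (s - w) : ℕ) : ℝ))
          = Real.sqrt N * ∑ z ∈ univ.erase x, w.crossLip 0 x z *
              Real.exp (t * (((linkEnds z).sup fun w => torusNorm (s - w) : ℕ) : ℝ)) := by
            rw [hEdef, mul_sum]; exact sum_congr rfl fun z _ => by ring
        _ ≤ Real.sqrt N * (Real.exp (2 * t) * w.crossLipLoad t x) := mul_le_mul_of_nonneg_left h1 (Real.sqrt_nonneg _)
        _ ≤ Real.sqrt N * (Real.exp (2 * t) * ε₁) := by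
            refine mul_le_mul_of_nonneg_left (mul_le_mul_of_nonneg_left ?_ (Real.exp_pos _).le) (Real.sqrt_nonneg _)
            linarith [crossLipLoad_mono w htκ x, hwℓ x, selfLipLoad_nonneg w κ x]
        _ = Real.exp (2 * t) * (Real.sqrt N * ε₁) := by ring
        _ ≤ Real.exp (2 * t) * lam := mul_le_mul_of_nonneg_left hlam (Real.exp_pos _).le
    rw [hρ]
    exact sum_Krob_mul_le' hd hL hc0 hΔ hgR.2.le hE0 hθ0 hθ1 (hrow s) hφ1 hΦb het hlamφ hx
  -- the covariance bound for the member's torus measure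
  intro F G ΔF ΔG δF δG n hFm hGm hFdep hGdep hFb hGb hFlip hGlip hdist
  have hFobs : LinkObs suFrobDist F ΔF δF := ⟨hFm, hFb, hFdep, hFlip.nonneg, hFlip.le⟩
  have hGobs : LinkObs suFrobDist G ΔG δG := ⟨hGm, hGb, hGdep, hGlip.nonneg, hGlip.le⟩
  have hL₀ : ∀ x ∈ ΔF, ∀ z ∈ ΔG, ∀ a ∈ linkEnds x, ∀ w' ∈ linkEnds z, n - 2 ≤ torusNorm (a - w') :=
    fun x hx z hz a ha w' hw' => le_torusNorm_linkEnds_sub (hdist x hx z hz) ha hw'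
  have key := spec_star_abs_covariance_le_weighted (isSpecification_perturbedTorusSpec W β)
    (isGibbsMeasure_perturbedMeasure W β) (r := suFrobDist) (R := 2 * Real.sqrt N) (by positivity)
    (fun p q => suFrobDist_le p q) (fun s y x => Krob_nonneg hd hc0 hΔ hE0 hθ0 hθ1 Kn s y x)
    hcontract hρ0 hρ1 ht hsumw hFobs hGobs (n - 2) hL₀
  refine key.trans ?_
  have hδF : 0 ≤ ∑ x ∈ ΔF, δF x := Finset.sum_nonneg fun x _ => hFlip.nonneg x
  have hδG : 0 ≤ ∑ y ∈ ΔG, δG y := Finset.sum_nonneg fun y _ => hGlip.nonneg y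
  have hn : (n : ℝ) - 2 ≤ ((n - 2 : ℕ) : ℝ) := by
    rcases Nat.lt_or_ge n 2 with h | h
    · rw [Nat.sub_eq_zero_of_le h.le]
      have : (n : ℝ) < 2 := by exact_mod_cast h
      simp; linarith
    · rw [Nat.cast_sub h]; push_cast; exact le_rfl
  have hexp : Real.exp (-(t * ((n - 2 : ℕ) : ℝ))) ≤ Real.exp (2 * t) * Real.exp (-t * n) := by
    rw [← Real.exp_add]
    refine Real.exp_le_exp.2 ?_
    nlinarith
  calc 2 * (2 * Real.sqrt N) ^ 2 * Real.exp (-(t * ((n - 2 : ℕ) : ℝ))) * (∑ x ∈ ΔF, δF x) * ∑ y ∈ ΔG, δG y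
      ≤ 2 * (2 * Real.sqrt N) ^ 2 * (Real.exp (2 * t) * Real.exp (-t * n)) * (∑ x ∈ ΔF, δF x) * ∑ y ∈ ΔG, δG y := by
        gcongr
    _ = 2 * (2 * Real.sqrt N) ^ 2 * Real.exp (2 * t) * (∑ y ∈ ΔG, δG y) * (∑ x ∈ ΔF, δF x) *
          Real.exp (-t * n) := by ring

/-! ### The ball: tier-2 torus clustering uniformly in `L`, up to `β⋆`, and Y4's weighted currency -/

/-- **TORUS CLUSTERING ON THE TIER-2 BALL THROUGH THE ROBUST STAR DOOR**, uniformly in the torus side `L ≥ 3`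
(`TorusClusteringOnBallW N d β κ ε₀ ε₁ (2(2√N)² e^{2t}) t`). [folklore] -/
theorem torusClusteringOnBallW_of_robustStar (hd : 2 ≤ d) (hN : 1 ≤ N) {β κ ε₀ ε₁ R K c lam θ ρ t : ℝ} (Kn : ℕ)
    (hK : 0 ≤ K) (hR : |β| / N * (2 * ((d : ℝ) - 1)) ≤ R) (hmod : OneLinkKRModulus N R K) (hε₁ : 0 ≤ ε₁)
    (ht : 0 ≤ t) (htκ : t ≤ κ)
    (hc : K * Real.exp ε₀ * (1 + 2 * Real.sqrt N * ε₁) * (|β| / N) ≤ c) (hlam : Real.sqrt N * ε₁ ≤ lam)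
    (hθ : θ = (2 * (d : ℝ) - 2) * c + lam) (hθ1 : θ < 1) (hcd : doorPoly d c < 1)
    (hρ : ρ = Real.exp t * (gaugeR d c +
      (Real.exp (2 * t) * lam + θ ^ Kn * (4 * d * (Real.exp (2 * t) * lam))) / (1 - θ))) (hρ1 : ρ < 1) :
    TorusClusteringOnBallW N d β κ ε₀ ε₁ (2 * (2 * Real.sqrt N) ^ 2 * Real.exp (2 * t)) t :=
  fun _L _ hL _W hW => clustersWith_of_robustStarW hd hN hL hK hR hmod hε₁ ht htκ hc hlam hθ hθ1 hcd hρ hρ1 hW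

/-- **… UP TO `β⋆`**: the weighted door at `β⋆ ≥ 0` serves every `0 ≤ β ≤ β⋆` with the SAME constants (the robust
coefficient is monotone in `|β|`). [folklore] -/
theorem torusClusteringOnBallW_upTo_of_robustStar (hd : 2 ≤ d) (hN : 1 ≤ N) {βs κ ε₀ ε₁ R K c lam θ ρ t : ℝ}
    (Kn : ℕ) (hK : 0 ≤ K) (hR : βs / N * (2 * ((d : ℝ) - 1)) ≤ R) (hmod : OneLinkKRModulus N R K)
    (hε₁ : 0 ≤ ε₁) (ht : 0 ≤ t) (htκ : t ≤ κ)
    (hc : K * Real.exp ε₀ * (1 + 2 * Real.sqrt N * ε₁) * (βs / N) ≤ c) (hlam : Real.sqrt N * ε₁ ≤ lam)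
    (hθ : θ = (2 * (d : ℝ) - 2) * c + lam) (hθ1 : θ < 1) (hcd : doorPoly d c < 1)
    (hρ : ρ = Real.exp t * (gaugeR d c +
      (Real.exp (2 * t) * lam + θ ^ Kn * (4 * d * (Real.exp (2 * t) * lam))) / (1 - θ))) (hρ1 : ρ < 1) :
    ∀ β : ℝ, 0 ≤ β → β ≤ βs → TorusClusteringOnBallW N d β κ ε₀ ε₁ (2 * (2 * Real.sqrt N) ^ 2 * Real.exp (2 * t)) t := by
  intro β hβ0 hββs
  have hβ : |β| ≤ βs := by rw [abs_of_nonneg hβ0]; exact hββs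
  have hN0 : (0 : ℝ) ≤ N := Nat.cast_nonneg _
  have hd2 : (2 : ℝ) ≤ d := by exact_mod_cast hd
  have hR' : |β| / N * (2 * ((d : ℝ) - 1)) ≤ R := by
    refine le_trans ?_ hR
    have : |β| / N ≤ βs / N := div_le_div_of_nonneg_right hβ hN0
    nlinarith
  have hc' : K * Real.exp ε₀ * (1 + 2 * Real.sqrt N * ε₁) * (|β| / N) ≤ c := by
    refine le_trans ?_ hc
    have : |β| / N ≤ βs / N := div_le_div_of_nonneg_right hβ hN0
    have hpos : 0 ≤ K * Real.exp ε₀ * (1 + 2 * Real.sqrt N * ε₁) := by positivity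
    exact mul_le_mul_of_nonneg_left this hpos
  exact torusClusteringOnBallW_of_robustStar hd hN Kn hK hR' hmod hε₁ ht htκ hc' hlam hθ hθ1 hcd hρ hρ1

/-- **Y4's receiving currency for `d = 3` on the WEIGHTED ball through the robust star door**:
`ClusterDomainClustering` for membership in `ClusterDomain κ ε₀ ε₁` up to `β⋆` at rate `t`. [folklore] -/
theorem clusterDomainClusteringW_dim3_of_robustStar (hN : 1 ≤ N) {βs κ ε₀ ε₁ R K c lam θ ρ t : ℝ}
    (Kn : ℕ) (hK : 0 ≤ K) (hR : βs / N * 4 ≤ R)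
    (hmod : OneLinkKRModulus N R K) (hε₁ : 0 ≤ ε₁) (ht : 0 ≤ t) (htκ : t ≤ κ)
    (hc : K * Real.exp ε₀ * (1 + 2 * Real.sqrt N * ε₁) * (βs / N) ≤ c)
    (hlam : Real.sqrt N * ε₁ ≤ lam) (hθ : θ = 4 * c + lam) (hθ1 : θ < 1) (hcd : doorPoly 3 c < 1)
    (hρ : ρ = Real.exp t * (gaugeR 3 c +
      (Real.exp (2 * t) * lam + θ ^ Kn * (12 * (Real.exp (2 * t) * lam))) / (1 - θ))) (hρ1 : ρ < 1) :
    YM3IR.ClusterDomainClustering (G := SUN N)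
      ⟨fundamentalRep (Fin N), βs, fun _ _ W => W ∈ ClusterDomain κ ε₀ ε₁⟩ suFrobDist t := by
  have e4 : (2 : ℝ) * (((3 : ℕ) : ℝ) - 1) = 4 := by norm_num
  have e4' : (2 : ℝ) * ((3 : ℕ) : ℝ) - 2 = 4 := by norm_num
  have e12 : (4 : ℝ) * ((3 : ℕ) : ℝ) * (Real.exp (2 * t) * lam) = 12 * (Real.exp (2 * t) * lam) := by push_cast; ring
  have h := torusClusteringOnBallW_upTo_of_robustStar (d := 3) (N := N) (by norm_num) hN Kn hK
    (βs := βs) (R := R) (by rw [e4]; exact hR) hmod hε₁ ht htκ hc hlam (by rw [e4']; exact hθ) hθ1 hcd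
    (by rw [e12]; exact hρ) hρ1
  exact clusterDomainClustering_of_torusClusteringOnBallW h

end Summit.Ventures.YMGap.RobustBall

end
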